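import Mathlib
import Literature.Computability.AlgebraicComplexity.NestFreeMatchingPoly
import Literature.Computability.AlgebraicComplexity.QuasiPolynomialFormulasProofs
import Summits.ValiantsHypothesis.ValiantsHypothesis.Theorems.FifoMatchingGridCorShadowExpCounts
import Summits.ValiantsHypothesis.ValiantsHypothesis.Theorems.FifoMatchingGridCorShadowRung
import Summits.ValiantsHypothesis.ValiantsHypothesis.Theorems.FifoMatchingGridCorCliqueFace
import Summits.ValiantsHypothesis.ValiantsHypothesis.Theses.FifoMatching
import HarnessLib

/-!
# R2-exp — the EXPONENTIAL rung of the NN division ladder (file 2 of 2): eventually `2^{⌊n^{1/8}⌋} < L₊(NN_n · h)` for EVERY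
# nonzero cofactor `h` of degree `≤ 2^{⌊n^{1/8}⌋}` — from the CLOSED route item G♭ `Theses.FifoMatching.GridCorCliqueFace`
# (stmt-27045) by the located faces of the shadow line, UNCONDITIONALLY

Port to `Theorems/` (director-valiant g13 R207 (a), val-lit desk l.7909: val-port-2 g1 = F9) of § ExpRung, second half, of
val-idea-7 g7's kernel-checked line workfile `Cruxes/NNLinearDegreeCofactorHard/Lines/shadow_division.lean` rev 10 @b49724032a2a
(l.2002–2191), verbatim bodies, with NO definitions (crit-3 #21b port note (a)): the line's `root8 n` is spelled
`Nat.sqrt (Nat.sqrt (Nat.sqrt n))` (`⌊n^{1/8}⌋`-ish: three nested integer square roots), its `NNExpDegreeCofactorHard` is spelled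
out over the library polynomial `nestFreeMatchingPoly n ℝ≥0` (definitionally the route's inlined `NN_n`), and the vertex counts
come from the sibling `…GridCorShadowExpCounts.lean`.  RATES MADE EXPLICIT: FORM A (G♭) is LINEAR (`c·t ≤ h`) and the K1 chain is
polynomial (`t ≈ √n/4`), so the located faces give `σ(NFP_n) ≥ 2^{Ω(√n)}` shadow vertices; with the tree's balancing theorem
(`formulaComplexity_le_two_pow`, BCS (21.35)/(21.36)) this yields monotone hardness `2^{n^{1/8}}` of `NN_n · h` for every nonzero
cofactor of degree `≤ 2^{n^{1/8}}` (the exponent `1/8` is bookkeeping slack).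

* `sixteen_mul_le_two_pow`, `two_log_le_root8`, `exp_threshold` — arithmetic: `2 log₂ n + 5 ≤ 2·⌊n^{1/8}⌋` for `n ≥ 2^64`; with
  `h ≥ c₀ · ⌊(⌊√n⌋/2 − 1)/2⌋`, `c₀ ∈ (0,1]`, eventually `18 (⌊n^{1/8}⌋ + 2 log₂ n + 5)² + 8 < h`.
* `expRung_of_count` — S-exp: the NFP count with a linear-in-`√n` exponent gives the exponential rung (F5
  `nn_ncard_extremePoints_le_of_multiple` = HY21 Thm 42 NN instance + `formulaComplexity_le_two_pow`).
* ★ `expRung_of_27045 (hF : GridCorCliqueFace)` and ★★ `expRung_holds` (over `gridCorCliqueFace_holds`, p622413) — **R2-exp**: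
  `∃ n₀, ∀ n ≥ n₀, ∀ h ≠ 0, deg h ≤ 2^{⌊n^{1/8}⌋} → 2^{⌊n^{1/8}⌋} < L₊(NN_n · h)`, UNCONDITIONAL.
* `expBound_of_expRung`, ★ `expBound_holds` — the `h = 1` instance: eventually `2^{⌊n^{1/8}⌋} < L₊(NN_n)` (explicit exponent;
  the route item 22994 `NNMonotoneExpBound` is the `∃ ε` form, closed independently by the thick-queue argument).

LADDER POSITION / HONEST FRAMING: R2-exp sits strictly ABOVE R2 = stmt-27271 `NNQuasiPolyLogDegreeCofactorHard`
(quasi-polynomial threshold AND degree cap; closer = val-port-4 g1) on the FifoMatching NN division ladder and strictly BELOW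
the residual stmt-21181 `NNDivisionHard` (all cofactors; residual N2♯, law-side); it is a SUPPORT-level record rung (tenure g12
files `NNExpDegreeCofactorHard`; until then this file is a helper `--supports stmt-ValiantsHypothesis-27271`, and its 1-line
closer follows by name), NOT a summit statement; `NNNotVP` is untouched; nothing here bears on `VP ≠ VNP`, which is NOT proved.

Sources: P. Hrubeš, A. Yehudayoff, *Shadows of Newton polytopes*, CCC 2021 (LIPIcs 200:9) [HrubesYehudayoff2021: Thm 42 /
Prop 43(2) / Rem 20 p.17]; M. Aboulker, S. Fiorini, T. Huynh, M. Macchia, J. Seif, Oper. Res. Lett. 47 (2019) [AboulkerEtAl2019,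
arXiv:1806.00541 pp. 5–6]; P. Bürgisser, M. Clausen, M. A. Shokrollahi, *Algebraic Complexity Theory* (1997), (21.35)/(21.36)
[BurgisserClausenShokrollahi1997].
-/

set_option autoImplicit false

-- the mandated summit-side namespace repeats a component by design (single-problem summit)
set_option linter.dupNamespace false

noncomputable section

namespace Summit.ValiantsHypothesis.ValiantsHypothesis.Theorems.FifoMatching

namespace GridCorShadow

open scoped NNReal
open MvPolynomial
open Literature.Computability.AlgebraicComplexity
open Literature.Combinatorics.Optimization (corVec)
open Literature.Computability.MetaComplexity (gridGraph)
open Summit.ValiantsHypothesis.ValiantsHypothesis.Theorems.FifoMatching.QueueGridFace (suppPts QGV patternVec)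
open Summit.ValiantsHypothesis.ValiantsHypothesis.Theses.FifoMatching (GridCorCliqueFace)

/-! ## Arithmetic of the exponent `⌊n^{1/8}⌋ = Nat.sqrt (Nat.sqrt (Nat.sqrt n))` -/

/-- `16 j + 19 ≤ 2^(j+1)` for `j ≥ 8`. -/
theorem sixteen_mul_le_two_pow (j : ℕ) (hj : 8 ≤ j) : 16 * j + 19 ≤ 2 ^ (j + 1) := by
  induction j, hj using Nat.le_induction with
  | base => norm_num
  | succ k hk ih =>
    have h16 : 16 ≤ 2 ^ (k + 1) := by
      calc (16 : ℕ) = 2 ^ 4 := by norm_num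
        _ ≤ 2 ^ (k + 1) := Nat.pow_le_pow_right (by norm_num) (by omega)
    calc 16 * (k + 1) + 19 = (16 * k + 19) + 16 := by ring
      _ ≤ 2 ^ (k + 1) + 2 ^ (k + 1) := Nat.add_le_add ih h16
      _ = 2 ^ (k + 1 + 1) := by ring

/-- `2 log₂ n + 5 ≤ 2 · ⌊n^{1/8}⌋` for `n ≥ 2^64` (`⌊n^{1/8}⌋` := three nested `Nat.sqrt`). -/
theorem two_log_le_root8 (n : ℕ) (hn : 2 ^ 64 ≤ n) :
    2 * Nat.log 2 n + 5 ≤ 2 * Nat.sqrt (Nat.sqrt (Nat.sqrt n)) := by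
  have hn0 : n ≠ 0 := by positivity
  set ℓ := Nat.log 2 n with hℓ
  have h64 : 64 ≤ ℓ := (Nat.le_log_iff_pow_le one_lt_two hn0).mpr hn
  set j := ℓ / 8 with hj
  have hj8 : 8 ≤ j := by omega
  have h8j : 8 * j ≤ ℓ := by omega
  have hℓj : ℓ ≤ 8 * j + 7 := by omega
  have hnℓ : 2 ^ ℓ ≤ n := Nat.pow_log_le_self 2 hn0
  have h1 : 2 ^ (4 * j) ≤ Nat.sqrt n := by
    rw [Nat.le_sqrt]
    calc 2 ^ (4 * j) * 2 ^ (4 * j) = 2 ^ (8 * j) := by rw [← pow_add]; ring_nf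
      _ ≤ 2 ^ ℓ := Nat.pow_le_pow_right (by norm_num) h8j
      _ ≤ n := hnℓ
  have h2 : 2 ^ (2 * j) ≤ Nat.sqrt (Nat.sqrt n) := by
    rw [Nat.le_sqrt]
    calc 2 ^ (2 * j) * 2 ^ (2 * j) = 2 ^ (4 * j) := by rw [← pow_add]; ring_nf
      _ ≤ Nat.sqrt n := h1
  have h3 : 2 ^ j ≤ Nat.sqrt (Nat.sqrt (Nat.sqrt n)) := by
    rw [Nat.le_sqrt]
    calc 2 ^ j * 2 ^ j = 2 ^ (2 * j) := by rw [← pow_add]; ring_nf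
      _ ≤ Nat.sqrt (Nat.sqrt n) := h2
  have h4 := sixteen_mul_le_two_pow j hj8
  calc 2 * ℓ + 5 ≤ 16 * j + 19 := by omega
    _ ≤ 2 ^ (j + 1) := h4
    _ = 2 * 2 ^ j := by ring
    _ ≤ 2 * Nat.sqrt (Nat.sqrt (Nat.sqrt n)) := Nat.mul_le_mul_left 2 h3

/-- the one real-arithmetic step: with `h ≥ c₀ · ⌊(⌊√n⌋/2 − 1)/2⌋`, `c₀ ∈ (0,1]`, eventually
`18 (⌊n^{1/8}⌋ + 2 log₂ n + 5)² + 8 < h`. -/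
theorem exp_threshold {c₀ : ℝ} (hc₀ : 0 < c₀) (hc₁ : c₀ ≤ 1) :
    ∃ n₁ : ℕ, ∀ n ≥ n₁, ∀ h : ℕ, c₀ * ((((Nat.sqrt n / 2 - 1) / 2 : ℕ)) : ℝ) ≤ h →
      18 * (Nat.sqrt (Nat.sqrt (Nat.sqrt n)) + 2 * Nat.log 2 n + 5) ^ 2 + 8 < h := by
  set N : ℕ := Nat.ceil (800 / c₀) with hN
  refine ⟨max (2 ^ 64) ((N * N) * (N * N)), fun n hn h hh => ?_⟩
  have h64 : 2 ^ 64 ≤ n := le_of_max_le_left hn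
  have hNN : (N * N) * (N * N) ≤ n := le_of_max_le_right hn
  set s₁ := Nat.sqrt n with hs₁
  set s₂ := Nat.sqrt s₁ with hs₂
  set s₃ := Nat.sqrt s₂ with hs₃
  -- `s₂ ≥ N`
  have hs₁N : N * N ≤ s₁ := by rw [hs₁, Nat.le_sqrt]; exact hNN
  have hs₂N : N ≤ s₂ := by rw [hs₂, Nat.le_sqrt]; exact hs₁N
  -- Nat facts
  have hlog : 2 * Nat.log 2 n + 5 ≤ 2 * s₃ := two_log_le_root8 n h64
  have hE : s₃ + 2 * Nat.log 2 n + 5 ≤ 3 * s₃ := by omega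
  have h33 : s₃ * s₃ ≤ s₂ := by rw [hs₃]; exact Nat.sqrt_le s₂
  have h22 : s₂ * s₂ ≤ s₁ := by rw [hs₂]; exact Nat.sqrt_le s₁
  have ht : s₁ ≤ 4 * ((s₁ / 2 - 1) / 2) + 7 := by omega
  have hEsq : 18 * (s₃ + 2 * Nat.log 2 n + 5) ^ 2 + 8 ≤ 162 * s₂ + 8 := by
    have := Nat.pow_le_pow_left hE 2
    nlinarith [this, h33]
  -- reals
  have hNr : 800 / c₀ ≤ (N : ℝ) := Nat.le_ceil _
  have hs₂r : (N : ℝ) ≤ s₂ := by exact_mod_cast hs₂N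
  have hcs : 800 ≤ c₀ * (s₂ : ℝ) := by
    have : c₀ * (800 / c₀) = 800 := by field_simp
    nlinarith [hNr, hs₂r, hc₀.le]
  have htr : ((s₁ : ℝ) - 7) / 4 ≤ (((s₁ / 2 - 1) / 2 : ℕ) : ℝ) := by
    have : (s₁ : ℝ) ≤ 4 * ((((s₁ / 2 - 1) / 2 : ℕ)) : ℝ) + 7 := by exact_mod_cast ht
    linarith
  have h22r : ((s₂ : ℝ)) * s₂ ≤ s₁ := by exact_mod_cast h22
  have hs₂1 : (1 : ℝ) ≤ s₂ := by
    have : (1 : ℕ) ≤ N := by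
      have h8 : (0 : ℝ) < 800 / c₀ := by positivity
      have : (0 : ℝ) < N := lt_of_lt_of_le h8 hNr
      exact_mod_cast this
    exact_mod_cast this.trans hs₂N
  have hmain : (162 * s₂ + 8 : ℝ) < h := by
    have h1 : c₀ * (((s₁ : ℝ) - 7) / 4) ≤ h := le_trans (mul_le_mul_of_nonneg_left htr hc₀.le) hh
    have h2 : c₀ * (((s₂ : ℝ) * s₂ - 7) / 4) ≤ c₀ * (((s₁ : ℝ) - 7) / 4) :=
      mul_le_mul_of_nonneg_left (by linarith) hc₀.le
    have h3 : (200 : ℝ) * s₂ - 7 / 4 ≤ c₀ * (((s₂ : ℝ) * s₂ - 7) / 4) := by nlinarith [hcs, hc₁, hc₀.le, hs₂1]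
    linarith
  have hmainN : 162 * s₂ + 8 < h := by exact_mod_cast hmain
  exact lt_of_le_of_lt hEsq hmainN

/-! ## S-exp and the rung -/

/-- **S-exp**: the NFP count with a linear-in-`√n` exponent gives the exponential rung — if it failed at a large `n` for
some `h ≠ 0`, `deg h ≤ 2^{⌊n^{1/8}⌋}`, `L₊(NN_n·h) ≤ 2^{⌊n^{1/8}⌋}`, then with `E = ⌊n^{1/8}⌋ + 2 log₂ n + 5` the balancing
theorem gives a monotone formula of size `2^{18E²}` and EVERY shadow of `NFP_n` has `≤ 2^{18E²+4}` vertices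
(`nn_ncard_extremePoints_le_of_multiple`, HY21 Thm 42), against a shadow with more than `2^{18E²+4}` vertices
(`16 · 2^{18E²+4} < 2^H`, `exp_threshold`). [cite: HrubesYehudayoff2021, Thm 42 and Prop 43(2)/Rem 20]
[cite: BurgisserClausenShokrollahi1997, Thm (21.35)/(21.36)] -/
theorem expRung_of_count {c₀ : ℝ} (hc₀ : 0 < c₀) (hc₁ : c₀ ≤ 1) {n₀ : ℕ}
    (hN : ∀ n ≥ n₀, ∃ h : ℕ, c₀ * ((((Nat.sqrt n / 2 - 1) / 2 : ℕ)) : ℝ) ≤ h ∧ ∀ B : ℕ, 16 * B < 2 ^ h →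
      ∃ L : ((Fin (2 * n) × Fin (2 * n)) → ℝ) →ₗ[ℝ] (Fin 2 → ℝ),
        B < (Set.extremePoints ℝ (convexHull ℝ (L '' suppPts (nestFreeMatchingPoly n ℝ≥0)))).ncard) :
    ∃ n₀ : ℕ, ∀ n ≥ n₀, ∀ h : MvPolynomial (Fin (2 * n) × Fin (2 * n)) ℝ≥0, h ≠ 0 →
      h.totalDegree ≤ 2 ^ Nat.sqrt (Nat.sqrt (Nat.sqrt n)) →
        2 ^ Nat.sqrt (Nat.sqrt (Nat.sqrt n)) < complexity (nestFreeMatchingPoly n ℝ≥0 * h) := by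
  obtain ⟨n₁, hn₁⟩ := exp_threshold hc₀ hc₁
  refine ⟨max n₀ n₁, fun n hn h hh hdeg => ?_⟩
  have hn0 : n₀ ≤ n := le_of_max_le_left hn
  have hn1 : n₁ ≤ n := le_of_max_le_right hn
  by_contra hs
  push Not at hs
  obtain ⟨H, hH, hcount⟩ := hN n hn0
  set ℓ := Nat.log 2 n with hℓ
  set m := Nat.sqrt (Nat.sqrt (Nat.sqrt n)) with hm
  set E := m + 2 * ℓ + 5 with hE
  have h2E : 2 ^ E = 2 ^ m * 2 ^ (ℓ + 1) * 2 ^ (ℓ + 1) * 8 := by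
    rw [hE, show m + 2 * ℓ + 5 = m + (ℓ + 1) + (ℓ + 1) + 3 by omega, pow_add, pow_add, pow_add]
    norm_num
  have hnlt : n < 2 ^ (ℓ + 1) := Nat.lt_pow_succ_log_self Nat.one_lt_two n
  have ha1 : 1 ≤ 2 ^ m := Nat.one_le_two_pow
  have hb1 : 1 ≤ 2 ^ (ℓ + 1) := Nat.one_le_two_pow
  have hprod : 2 ^ (ℓ + 1) * 2 ^ (ℓ + 1) ≤ 2 ^ m * 2 ^ (ℓ + 1) * 2 ^ (ℓ + 1) := by
    calc 2 ^ (ℓ + 1) * 2 ^ (ℓ + 1) = 1 * 2 ^ (ℓ + 1) * 2 ^ (ℓ + 1) := by ring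
      _ ≤ 2 ^ m * 2 ^ (ℓ + 1) * 2 ^ (ℓ + 1) := Nat.mul_le_mul_right _ (Nat.mul_le_mul_right _ ha1)
  have hsq : 2 ^ (ℓ + 1) ≤ 2 ^ (ℓ + 1) * 2 ^ (ℓ + 1) := Nat.le_mul_of_pos_right _ (by omega)
  have hBle : 2 ^ m ≤ 2 ^ m * 2 ^ (ℓ + 1) * 2 ^ (ℓ + 1) := by
    calc 2 ^ m = 2 ^ m * 1 * 1 := by ring
      _ ≤ 2 ^ m * 2 ^ (ℓ + 1) * 2 ^ (ℓ + 1) := Nat.mul_le_mul (Nat.mul_le_mul_left _ hb1) hb1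
  have hd : n + 2 ^ m < 2 ^ E := by rw [h2E]; omega
  have hcard : Fintype.card (Fin (2 * n) × Fin (2 * n)) ≤ 2 ^ E := by
    rw [Fintype.card_prod, Fintype.card_fin, h2E]
    calc 2 * n * (2 * n) = 4 * (n * n) := by ring
      _ ≤ 4 * (2 ^ (ℓ + 1) * 2 ^ (ℓ + 1)) := Nat.mul_le_mul_left 4 (Nat.mul_le_mul hnlt.le hnlt.le)
      _ ≤ 4 * (2 ^ m * 2 ^ (ℓ + 1) * 2 ^ (ℓ + 1)) := Nat.mul_le_mul_left 4 hprod
      _ ≤ 2 ^ m * 2 ^ (ℓ + 1) * 2 ^ (ℓ + 1) * 8 := by omega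
  have hNN : (nestFreeMatchingPoly n ℝ≥0).totalDegree ≤ n := by
    simpa using (nestFreeMatchingPoly_isHomogeneous (n := n) (k := ℝ≥0)).totalDegree_le
  have hdeg' : (nestFreeMatchingPoly n ℝ≥0 * h).totalDegree ≤ n + 2 ^ m :=
    calc (nestFreeMatchingPoly n ℝ≥0 * h).totalDegree
        ≤ (nestFreeMatchingPoly n ℝ≥0).totalDegree + h.totalDegree := totalDegree_mul _ _
      _ ≤ n + 2 ^ m := add_le_add hNN hdeg
  have hL' : complexity (nestFreeMatchingPoly n ℝ≥0 * h) ≤ 2 ^ E :=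
    hs.trans (Nat.pow_le_pow_right Nat.two_pos (by omega : m ≤ E))
  have hE1 : 1 ≤ E := by omega
  have hfc := formulaComplexity_le_two_pow hdeg' hd hcard hL' hE1
  have harith : 18 * E ^ 2 + 8 < H := hn₁ n hn1 H hH
  obtain ⟨L, hL⟩ := hcount (2 ^ (18 * E ^ 2 + 4)) (by
    calc 16 * 2 ^ (18 * E ^ 2 + 4) = 2 ^ (18 * E ^ 2 + 8) := by
          have h8 : 18 * E ^ 2 + 8 = (18 * E ^ 2 + 4) + 4 := by omega
          rw [h8, pow_add _ (18 * E ^ 2 + 4) 4]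
          have h16 : (2 : ℕ) ^ 4 = 16 := by norm_num
          rw [h16]; omega
      _ < 2 ^ H := Nat.pow_lt_pow_right (by norm_num) harith)
  have hV := nn_ncard_extremePoints_le_of_multiple L h hh
  have hfinal : (Set.extremePoints ℝ (convexHull ℝ (L '' suppPts (nestFreeMatchingPoly n ℝ≥0)))).ncard ≤
      2 ^ (18 * E ^ 2 + 4) :=
    calc (Set.extremePoints ℝ (convexHull ℝ (L '' suppPts (nestFreeMatchingPoly n ℝ≥0)))).ncard
        ≤ 4 * (3 * formulaComplexity (nestFreeMatchingPoly n ℝ≥0 * h) + 1) := hV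
      _ ≤ 4 * (3 * 2 ^ (18 * E ^ 2) + 1) :=
          Nat.mul_le_mul_left 4 (Nat.add_le_add_right (Nat.mul_le_mul_left 3 hfc) 1)
      _ ≤ 2 ^ (18 * E ^ 2 + 4) := by
          rw [pow_add]
          have h16 : (2 : ℕ) ^ 4 = 16 := by norm_num
          rw [h16]
          have := Nat.one_le_two_pow (n := 18 * E ^ 2)
          omega
  exact absurd hL (not_lt.2 hfinal)

/-- ★ **R2-exp from G♭, BY NAME**: the route item `GridCorCliqueFace` (stmt-27045) gives — eventually in `n` —
`2^{⌊n^{1/8}⌋} < L₊(NN_n · h)` for every nonzero cofactor `h` of total degree `≤ 2^{⌊n^{1/8}⌋}`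
(`⌊n^{1/8}⌋ := Nat.sqrt (Nat.sqrt (Nat.sqrt n))`; A1 via `queueGridZeroOnePoints_holds`).
[cite: HrubesYehudayoff2021, Prop 43(2)/Rem 20 with Prop 19 / Lemma 10 / Thm 42] [cite: AboulkerEtAl2019, Thm 6 (pp. 5–6)] -/
theorem expRung_of_27045 (hF : GridCorCliqueFace) :
    ∃ n₀ : ℕ, ∀ n ≥ n₀, ∀ h : MvPolynomial (Fin (2 * n) × Fin (2 * n)) ℝ≥0, h ≠ 0 →
      h.totalDegree ≤ 2 ^ Nat.sqrt (Nat.sqrt (Nat.sqrt n)) →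
        2 ^ Nat.sqrt (Nat.sqrt (Nat.sqrt n)) < complexity (nestFreeMatchingPoly n ℝ≥0 * h) := by
  obtain ⟨c₀, hc₀, t₀, hG⟩ := gridCor_count hF
  have hc₁ : 0 < min c₀ 1 := lt_min hc₀ one_pos
  have hc₁1 : min c₀ 1 ≤ 1 := min_le_right _ _
  have hG' : ∀ t ≥ t₀, ∃ h : ℕ, min c₀ 1 * t ≤ h ∧ ∀ B : ℕ, 4 * B < 2 ^ h →
      ∃ L : ((Fin (t * t) × Fin (t * t)) → ℝ) →ₗ[ℝ] (Fin 2 → ℝ),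
        B < (Set.extremePoints ℝ (convexHull ℝ (L '' Set.range (corVec (gridGraph t))))).ncard := by
    intro t ht
    obtain ⟨h, hh, hc⟩ := hG t ht
    exact ⟨h, (mul_le_mul_of_nonneg_right (min_le_left _ _) (Nat.cast_nonneg t)).trans hh, hc⟩
  have hP : ∀ r ≥ 2 * t₀ + 2, _ := fun r hr => pp_count hG' r hr
  have hN : ∀ n ≥ 4 * (max (2 * t₀ + 2 + 1) 3) ^ 2, _ := fun n hn => nfp_count hP n hn
  exact expRung_of_count hc₁ hc₁1 hN

/-- ★★ **R2-exp HOLDS, UNCONDITIONALLY**: eventually in `n`, `2^{⌊n^{1/8}⌋} < L₊(NN_n · h)` for every nonzero cofactor `h`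
of total degree `≤ 2^{⌊n^{1/8}⌋}` — from the CLOSED item 27045 (`gridCorCliqueFace_holds`, p622413: AFHMS 2019 in the tree),
A1 (`queueGridZeroOnePoints_holds`), HY21 Prop 19 / Lemma 10 / Thm 42 and BCS balancing, all kernel theorems.  Contains R2
(stmt-27271: quasi-polynomial degree & threshold, eventually) and the `h = 1` exponential bound.
[cite: HrubesYehudayoff2021, Prop 43(2)/Rem 20] [cite: AboulkerEtAl2019, Thm 6 (pp. 5–6)] -/
theorem expRung_holds :
    ∃ n₀ : ℕ, ∀ n ≥ n₀, ∀ h : MvPolynomial (Fin (2 * n) × Fin (2 * n)) ℝ≥0, h ≠ 0 →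
      h.totalDegree ≤ 2 ^ Nat.sqrt (Nat.sqrt (Nat.sqrt n)) →
        2 ^ Nat.sqrt (Nat.sqrt (Nat.sqrt n)) < complexity (nestFreeMatchingPoly n ℝ≥0 * h) :=
  expRung_of_27045 gridCorCliqueFace_holds

/-- the `h = 1` instance of R2-exp: an explicit-exponent eventual exponential bound for `NN_n` itself. -/
theorem expBound_of_expRung
    (hX : ∃ n₀ : ℕ, ∀ n ≥ n₀, ∀ h : MvPolynomial (Fin (2 * n) × Fin (2 * n)) ℝ≥0, h ≠ 0 →
      h.totalDegree ≤ 2 ^ Nat.sqrt (Nat.sqrt (Nat.sqrt n)) →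
        2 ^ Nat.sqrt (Nat.sqrt (Nat.sqrt n)) < complexity (nestFreeMatchingPoly n ℝ≥0 * h)) :
    ∃ n₀ : ℕ, ∀ n ≥ n₀, 2 ^ Nat.sqrt (Nat.sqrt (Nat.sqrt n)) < complexity (nestFreeMatchingPoly n ℝ≥0) := by
  obtain ⟨n₀, hX⟩ := hX
  refine ⟨n₀, fun n hn => ?_⟩
  simpa using hX n hn 1 one_ne_zero (by simp)

/-- ★ **eventually `2^{⌊n^{1/8}⌋} < L₊(NN_n)`** (explicit exponent, UNCONDITIONAL; the route item 22994 `NNMonotoneExpBound`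
is the `∃ ε` form, closed independently by the thick-queue argument). -/
theorem expBound_holds :
    ∃ n₀ : ℕ, ∀ n ≥ n₀, 2 ^ Nat.sqrt (Nat.sqrt (Nat.sqrt n)) < complexity (nestFreeMatchingPoly n ℝ≥0) :=
  expBound_of_expRung expRung_holds

end GridCorShadow

end Summit.ValiantsHypothesis.ValiantsHypothesis.Theorems.FifoMatching

end
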